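import Literature.Analysis.FluidPDE.StatisticalSolutionEnergyEq
import Literature.Analysis.FluidPDE.NSStrongSolutions2D
import Summits.AnomalousDissipation.AnomalousDissipation.Theorems.KolmogorovFloor.Negative.FarField
import HarnessLib

/-!
# Stub `stub_scalingCovariance` of line `sweep-test-cyclic-tlf-witness`
# (crux `TaylorCertificates.EnsembleCeiling`, stmt-AnomalousDissipation-14090)

EXACT AMPLITUDE COVARIANCE OF THE FMRT CLASS.  For every viscosity `ν`, force `f` on `T³` and
scale `c > 0`: the push-forward of a stationary statistical solution `μ` of `NS_ν(f)`
(Foias–Manley–Rosa–Temam, Ch. IV Def. 1.3: `Torus.IsStationaryStatisticalSolution ν f μ`) under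
the dilation `u ↦ c • u` of the energy space `H` is a stationary statistical solution of
`NS_{cν}(c² f)`.  This is the zeroth lemma of every blow-down argument on the line (the hot
rung is stated in blown-down variables and recovered through this covariance).

**Proof**, field by field of `Torus.IsStationaryStatisticalSolution`.  The dilation is a
homeomorphism of `H` (`Homeomorph.smulOfNeZero`), hence a measurable embedding, so push-forward
integrals are computed by substitution with no measurability bookkeeping
(`MeasurableEmbedding.lintegral_map / integrable_map_iff / integral_map / setIntegral_map`).
* `prob`: push-forwards of probability measures are probability measures.
* (1.29): `‖∇(c•u)‖² = c²‖∇u‖²` (the `L²` representative of `c • u` is a.e. `c •` that of `u`,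
  and the spectral enstrophy scales quadratically), so the mean enstrophy scales by `c² < ∞`.
* (1.30): given a cylindrical test functional `Φ` (fields `gᵢ`, profile `φ`), let `Φ_c` have
  the fields `c • gᵢ` and the same profile.  Then `Φ_c` has at `u` the coordinates of `Φ` at
  `c • u`, so `Φ'(c•u) = c⁻¹ Φ_c'(u)`, and term by term
  `⟨F_{cν, c²f}(c•u), c⁻¹ w⟩ = c ⟨F_{ν, f}(u), w⟩` for the smooth field `w = Φ_c'(u)` (all three
  pairings are Bochner integrals, linear in constants unconditionally; `Δ` and `D` are linear).
  Integrability and vanishing of the Liouville integrand therefore transfer from `μ` tested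
  against `Φ_c`.
* (1.31): the preimage of the shell `{e₁ ≤ |u|² < e₂}` under the dilation is the shell
  `{e₁/c² ≤ |u|² < e₂/c²}`, and the integrand `ν‖∇u‖² − (u, f)` evaluated at `(cν, c²f, c•u)`
  is `c³` times its value at `(ν, f, u)`; so the shell inequality for `μ` on the rescaled shell,
  multiplied by `c³ > 0`, is the shell inequality for the push-forward.
No hypothesis on `f` is needed.

References: C. Foias, O. Manley, R. Rosa, R. Temam, *Navier–Stokes Equations and Turbulence*,
Cambridge Univ. Press (2001), Ch. IV §1.2, Def. 1.3, (1.29)–(1.31).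
-/

-- `Summit.<Summit>.<Problem>` is the tree's mandated summit-side namespace (CONVENTIONS §2); for this
-- single-conjunct summit the two coincide, so the duplicate is deliberate.
set_option linter.dupNamespace false

noncomputable section

namespace Summit.AnomalousDissipation.AnomalousDissipation.Theorems.TaylorCertificatesEnsembleCeiling

open MeasureTheory UnitAddTorus
open scoped InnerProductSpace ENNReal
open Literature.Analysis.FunctionSpaces Literature.Analysis.FluidPDE
open Summit.AnomalousDissipation.AnomalousDissipation.Theorems.KolmogorovFloor.Negative

/-- Local notation: real vector fields on `T³`. -/
local notation "Vec3" => ((UnitAddTorus (Fin 3)) → (EuclideanSpace ℝ (Fin 3)))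
/-- Local notation: `L²(T³; ℝ³)`. -/
local notation "L2" => (Lp (EuclideanSpace ℝ (Fin 3)) 2 (volume : Measure (UnitAddTorus (Fin 3))))
/-- Local notation: the energy space `H`. -/
local notation "H3" => (Torus.energySpace (Fin 3))

namespace ScalingCovariance

/-! ## Scaling of states (adapted from the line skeleton's scaling helpers) -/

/-- The `L²` representative of `c • u` is a.e. `c •` the representative of `u`. -/
theorem coeFn_coe_smul (c : ℝ) (u : H3) :
    (((c • u : H3) : L2) : Vec3) =ᵐ[volume] c • (((u : H3) : L2) : Vec3) := by
  rw [Submodule.coe_smul]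
  exact Lp.coeFn_smul c ((u : H3) : L2)

/-- Spectral enstrophy of a scaled state: `‖∇(c•u)‖² = c²‖∇u‖²`. -/
theorem eGradNormSq_coe_smul (c : ℝ) (u : H3) :
    Torus.eGradNormSq (((c • u : H3) : L2) : Vec3) =
      ENNReal.ofReal (c ^ 2) * Torus.eGradNormSq (((u : H3) : L2) : Vec3) := by
  rw [eGradNormSq_congr_ae (coeFn_coe_smul c u), eGradNormSq_const_smul]

/-- `toReal` form of `eGradNormSq_coe_smul`. -/
theorem toReal_eGradNormSq_coe_smul (c : ℝ) (u : H3) :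
    (Torus.eGradNormSq (((c • u : H3) : L2) : Vec3)).toReal =
      c ^ 2 * (Torus.eGradNormSq (((u : H3) : L2) : Vec3)).toReal := by
  rw [eGradNormSq_coe_smul, ENNReal.toReal_mul, ENNReal.toReal_ofReal (sq_nonneg c)]

/-- Pairing of a scaled state: `(c•u, g) = c·(u, g)` (no integrability needed). -/
theorem pairing_coe_smul (c : ℝ) (u : H3) (g : Vec3) :
    Torus.pairing ((c • u : H3) : L2) g = c * Torus.pairing ((u : H3) : L2) g := by
  unfold Torus.pairing
  rw [← integral_const_mul]
  refine integral_congr_ae ?_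
  filter_upwards [coeFn_coe_smul c u] with x hx
  rw [hx, Pi.smul_apply, real_inner_smul_left]

/-- Pairing against a scaled field: `(v, a g) = a·(v, g)` (no integrability needed). -/
theorem pairing_smul_right (v : L2) (a : ℝ) (g : Vec3) :
    Torus.pairing v (fun x => a • g x) = a * Torus.pairing v g := by
  unfold Torus.pairing
  rw [← integral_const_mul]
  refine integral_congr_ae (Filter.Eventually.of_forall fun x => ?_)
  dsimp only
  rw [real_inner_smul_right]

/-! ## Scaling of the Navier–Stokes generator pairing -/

/-- **Covariance of the generator**: `⟨F_{cν, c²f}(c•u), c⁻¹ • w⟩ = c · ⟨F_{ν, f}(u), w⟩` for a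
smooth test field `w` and `c ≠ 0`, term by term (force, Stokes and inertial pairings are Bochner
integrals, homogeneous in constants with or without integrability). -/
theorem nsGeneratorPairing_smul {c : ℝ} (hc : c ≠ 0) (ν : ℝ) (f : Vec3) (u : H3) {w : Vec3}
    (hw : Torus.IsSmooth w) :
    Torus.nsGeneratorPairing (c * ν) (fun x => c ^ 2 • f x) (c • u) (c⁻¹ • w) =
      c * Torus.nsGeneratorPairing ν f u w := by
  unfold Torus.nsGeneratorPairing Torus.inertialPairing
  -- the force term
  have h1 : (∫ x, ⟪c ^ 2 • f x, (c⁻¹ • w) x⟫_ℝ) = c * ∫ x, ⟪f x, w x⟫_ℝ := by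
    rw [← integral_const_mul]
    refine integral_congr_ae (Filter.Eventually.of_forall fun x => ?_)
    dsimp only
    rw [Pi.smul_apply, real_inner_smul_left, real_inner_smul_right, ← mul_assoc, pow_two, mul_assoc c c,
      mul_inv_cancel₀ hc, mul_one]
  -- the Stokes term
  have h2 : (∫ x, ⟪(((c • u : H3) : L2) : Vec3) x, Torus.laplacian (c⁻¹ • w) x⟫_ℝ) =
      ∫ x, ⟪(((u : H3) : L2) : Vec3) x, Torus.laplacian w x⟫_ℝ := by
    refine integral_congr_ae ?_
    filter_upwards [coeFn_coe_smul c u] with x hx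
    rw [hx, Torus.laplacian_const_smul_apply hw, Pi.smul_apply, real_inner_smul_left,
      real_inner_smul_right, ← mul_assoc, mul_inv_cancel₀ hc, one_mul]
  -- the inertial term
  have h3 : (∫ x, ⟪Torus.fderiv (c⁻¹ • w) x ((((c • u : H3) : L2) : Vec3) x),
      (((c • u : H3) : L2) : Vec3) x⟫_ℝ) =
      c * ∫ x, ⟪Torus.fderiv w x ((((u : H3) : L2) : Vec3) x), (((u : H3) : L2) : Vec3) x⟫_ℝ := by
    rw [← integral_const_mul]
    refine integral_congr_ae ?_
    filter_upwards [coeFn_coe_smul c u] with x hx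
    rw [hx, Torus.fderiv_const_smul (hw.isContDiff (by simp)) c⁻¹ x, Pi.smul_apply,
      smul_apply, map_smul, real_inner_smul_left, real_inner_smul_left,
      real_inner_smul_right, ← mul_assoc, inv_mul_cancel₀ hc, one_mul]
  rw [h1, h2, h3]
  ring

/-! ## The rescaled cylindrical test functional -/

/-- The coordinates of `u` seen through the rescaled test functional `Φ_c` (fields `c • gᵢ`, same
profile) are the coordinates of `c • u` seen through `Φ`. -/
theorem coords_smul (c : ℝ) (Φ : Torus.CylindricalTest (Fin 3)) (u : H3) :
    (⟨Φ.m, fun i => c • Φ.g i, fun i => (Φ.g_smooth i).smul c,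
        fun i => isDivFree_const_smul (Φ.g_smooth i) (Φ.g_divFree i) c,
        fun i => hasZeroMean_const_smul (Φ.g_zeroMean i) c, Φ.φ, Φ.φ_contDiff, Φ.φ_compact⟩ :
        Torus.CylindricalTest (Fin 3)).coords u = Φ.coords (c • u) := by
  unfold Torus.CylindricalTest.coords
  congr 1
  funext i
  dsimp only
  rw [show (c • Φ.g i) = fun x => c • Φ.g i x from rfl, pairing_smul_right, pairing_coe_smul]

/-- `Φ'(c • u) = c⁻¹ • Φ_c'(u)` for the rescaled test functional `Φ_c`, `c ≠ 0`. -/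
theorem grad_smul {c : ℝ} (hc : c ≠ 0) (Φ : Torus.CylindricalTest (Fin 3)) (u : H3) :
    Φ.grad (c • u) = c⁻¹ •
      (⟨Φ.m, fun i => c • Φ.g i, fun i => (Φ.g_smooth i).smul c,
        fun i => isDivFree_const_smul (Φ.g_smooth i) (Φ.g_divFree i) c,
        fun i => hasZeroMean_const_smul (Φ.g_zeroMean i) c, Φ.φ, Φ.φ_contDiff, Φ.φ_compact⟩ :
        Torus.CylindricalTest (Fin 3)).grad u := by
  unfold Torus.CylindricalTest.grad
  rw [coords_smul c Φ u]
  funext x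
  dsimp only
  rw [Pi.smul_apply, Finset.smul_sum]
  refine Finset.sum_congr rfl fun i _ => ?_
  rw [Pi.smul_apply, smul_smul, smul_smul]
  congr 1
  rw [mul_comm _ c, ← mul_assoc, mul_inv_cancel₀ hc, one_mul]

end ScalingCovariance

open ScalingCovariance

/-- **Exact amplitude covariance of stationary statistical solutions.**  For every viscosity
`ν`, force `f` on `T³`, scale `c > 0` and stationary statistical solution `μ` of `NS_ν(f)`
(FMRT Ch. IV Def. 1.3), the push-forward of `μ` under the dilation `u ↦ c • u` of `H` is a
stationary statistical solution of `NS_{cν}(c² f)`.  No hypothesis on `f`. -/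
theorem stub_scalingCovariance :
    ∀ (ν c : ℝ) (f : Vec3) (μ : Measure H3), 0 < c →
      Torus.IsStationaryStatisticalSolution ν f μ →
        Torus.IsStationaryStatisticalSolution (c * ν) (fun x => c ^ 2 • f x)
          (Measure.map (fun u : H3 => c • u) μ) := by
  intro ν c f μ hc hμ
  have hc0 : c ≠ 0 := hc.ne'
  have hge : MeasurableEmbedding (fun u : H3 => c • u) :=
    (Homeomorph.smulOfNeZero c hc0).measurableEmbedding
  haveI := hμ.prob
  refine ⟨Measure.isProbabilityMeasure_map hge.measurable.aemeasurable, ?_, ?_, ?_⟩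
  · -- (1.29) finite mean enstrophy
    rw [hge.lintegral_map]
    simp_rw [eGradNormSq_coe_smul c]
    rw [lintegral_const_mul' _ _ ENNReal.ofReal_ne_top]
    exact ENNReal.mul_lt_top ENNReal.ofReal_lt_top hμ.enstrophy_finite
  · -- (1.30) the stationary Liouville equation
    intro Φ
    set Φc : Torus.CylindricalTest (Fin 3) :=
      ⟨Φ.m, fun i => c • Φ.g i, fun i => (Φ.g_smooth i).smul c,
        fun i => isDivFree_const_smul (Φ.g_smooth i) (Φ.g_divFree i) c,
        fun i => hasZeroMean_const_smul (Φ.g_zeroMean i) c, Φ.φ, Φ.φ_contDiff, Φ.φ_compact⟩ with hΦc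
    have hgen : ∀ u : H3,
        Torus.nsGeneratorPairing (c * ν) (fun x => c ^ 2 • f x) (c • u) (Φ.grad (c • u)) =
          c * Torus.nsGeneratorPairing ν f u (Φc.grad u) := by
      intro u
      rw [grad_smul hc0 Φ u, ← hΦc]
      exact nsGeneratorPairing_smul hc0 ν f u (Torus.CylindricalTest.isSmooth_grad_holds Φc u)
    obtain ⟨hint, h0⟩ := hμ.generator Φc
    refine ⟨?_, ?_⟩
    · rw [hge.integrable_map_iff]
      have hcomp : ((fun u : H3 => Torus.nsGeneratorPairing (c * ν) (fun x => c ^ 2 • f x) u (Φ.grad u)) ∘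
          fun u : H3 => c • u) = fun u => c * Torus.nsGeneratorPairing ν f u (Φc.grad u) := by
        funext u
        exact hgen u
      rw [hcomp]
      exact hint.const_mul c
    · rw [hge.integral_map]
      simp_rw [hgen]
      rw [integral_const_mul, h0, mul_zero]
  · -- (1.31) the shell energy inequality
    intro e₁ e₂ h12
    rw [hge.setIntegral_map]
    have hC0 : ‖c‖ₑ ^ 2 ≠ 0 := pow_ne_zero 2 (enorm_ne_zero.2 hc0)
    have hCt : ‖c‖ₑ ^ 2 ≠ ∞ := ENNReal.pow_ne_top enorm_ne_top
    have hset : (fun u : H3 => c • u) ⁻¹' {u : H3 | e₁ ≤ ‖u‖ₑ ^ 2 ∧ ‖u‖ₑ ^ 2 < e₂} =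
        {u : H3 | e₁ / ‖c‖ₑ ^ 2 ≤ ‖u‖ₑ ^ 2 ∧ ‖u‖ₑ ^ 2 < e₂ / ‖c‖ₑ ^ 2} := by
      ext u
      simp only [Set.mem_preimage, Set.mem_setOf_eq]
      rw [enorm_smul, mul_pow, mul_comm (‖c‖ₑ ^ 2) (‖u‖ₑ ^ 2),
        ENNReal.div_le_iff_le_mul (Or.inl hC0) (Or.inl hCt),
        ENNReal.lt_div_iff_mul_lt (Or.inl hC0) (Or.inl hCt)]
    have hI : ∀ u : H3,
        c * ν * (Torus.eGradNormSq ((((c • u : H3) : L2)) : Vec3)).toReal -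
            Torus.pairing ((c • u : H3) : L2) (fun x => c ^ 2 • f x) =
          c ^ 3 * (ν * (Torus.eGradNormSq (((u : H3) : L2) : Vec3)).toReal -
            Torus.pairing ((u : H3) : L2) f) := by
      intro u
      rw [toReal_eGradNormSq_coe_smul, pairing_coe_smul, pairing_smul_right]
      ring
    rw [hset]
    simp_rw [hI]
    rw [integral_const_mul]
    exact mul_nonpos_of_nonneg_of_nonpos (pow_pos hc 3).le
      (hμ.energy_ineq _ _ (ENNReal.div_lt_div_right hC0 hCt h12))

end Summit.AnomalousDissipation.AnomalousDissipation.Theorems.TaylorCertificatesEnsembleCeiling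

end
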